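import Summits.CriticalPhenomena.PercolationContinuityZ3.Theorems.PercNearOneGluingNoHeavyQuantIncomeCriterion
import Summits.CriticalPhenomena.PercolationContinuityZ3.Theorems.PercNearOneGluingNoHeavyQuantGateMoveBlobCellsZero
import Summits.CriticalPhenomena.PercolationContinuityZ3.Theorems.PercNearOneGluingNoHeavyQuantGateMoveBlobCells
import Summits.CriticalPhenomena.PercolationContinuityZ3.Theorems.PercNearOneGluingNoHeavyQuantSliceHeavy
import Summits.CriticalPhenomena.PercolationContinuityZ3.Theorems.PercNearOneGluingNoHeavyQuantGatedSliceWindow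
import HarnessLib

/-!
# QUANT lane R8, T-DEC, leg (III), blob case — `LawDec.GatedSliceMixLaw'`, the Q-ALONE side in REGIME R: the EXPLICIT ROUTING THEOREM for
# the five-atom law `Q = zδ₀ + (1−z)·slice {k₁,k₂;λ} a g` when `k₁ ≥ 1` is the only nonzero `t`-low (classes `{m,M,G}×{m,M,G}` of the
# census) — ship `k₁` into its own twin `k₁+a`, the top `k₂` and the shifted top `k₂+a` by given amounts, and the zero fits the leftovers

builds on p205010 (kernel theorem, internal audit signed; external expert review pending)

Support file (`--supports stmt-CriticalPhenomena-4575`), QUANT lane seat prim-quant-arm-1 (gen 41), rung R8 of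
`run/shared/lean/prim/quant/LADDER.md`.  Theorems only, standard axioms, no sorries, no definitions.  Companion of `…QuantGatedSliceMixLawQAlone`
(this seat: cells (Q1) `k₂+a ≤ j`, (Q2′) no nonzero `t`-low), `…QuantGatedSliceMixLawPrime` (typer g29: the node), `…QuantIncomeCriterion`
(arm-1 g39: `flowAtT_of_offers`).

THE SETTING (regime R of the node, lead g31 N121 / this seat's census `work/explore/qdec.py`, `qcells.py`).  Frame `0 < y < 1`, `0 ≤ z < 1`,
`g ≤ 1`, `y ≤ (1−z)g`, `1 ≤ a`, `j < M + a`, `y·M ≤ S`; `μ₂ = {k₁, k₂; λ}`, `(1−z)(k₁ + (k₂−k₁)λ) = S`, `t = S + ag(1−z)`;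
`Q := zδ₀ + (1−z)·slice μ₂ a g = z·δ₀ + A·δ_{k₁} + B·δ_{k₁+a} + C·δ_{k₂} + D·δ_{k₂+a}`, `A = (1−z)(1−λ)(1−g)`, `B = (1−z)(1−λ)g`,
`C = (1−z)λ(1−g)`, `D = (1−z)λg` (`mixLawQ_eq_atoms`).  Here: `1 ≤ k₁ ≤ j`, `2k₁ < t` (a nonzero low), the twin `P = k₁ + a` and the top
`K = k₂` are NOT `t`-lows (`t ≤ 2P ∨ j < P`, `t ≤ 2K ∨ j < K`), and the shifted top `G = k₂ + a ≥ j + 1` is a giant.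

THE THEOREM (`mixLawQ_decAtT_of_routing`).  For amounts `x_P, x_K, x_G ≥ 0` with `x_P + x_K + x_G = A` (how the low `k₁` is shipped), each
used only on a COMPATIBLE absorber (`x_P > 0 ⟹ j+1 ≤ P ∨ t < k₁ + P`, same for `K`; `G` is a giant), within capacity at the usage rates of
`…QuantLawDecFlows` (`usage(k₁,P)·x_P ≤ B`, `usage(k₁,K)·x_K ≤ C`, `usage(k₁,G)·x_G ≤ D`), and such that THE ZERO FITS THE LEFTOVERS AT ITS
OWN RATES — `t·z ≤ Σ_{X ∈ {P,K,G}} κ(X)·(mass X − usage(k₁,X)·x_X)`, `κ(X) = t(1−y)/y` for a giant, `X − t` for a mid above `t`, `0` for a mid at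
or below `t` — the law `Q` is `DECAtT y t j (M+a)`, i.e. `GatedSliceMixLaw'` holds there with `θ = 0` (`gatedSliceMixLaw'_of_routing`).  This is
arm-1 g39's offers criterion `flowAtT_of_offers` with the bookkeeping of the five-atom law discharged; coincident positions (`k₁ + a = k₂`) are
allowed (the loads add).  EXACT CENSUS (this seat, `work/explore/qroute.py`, `qpiece.py`; ≈ 120 000 regime-R instances, M ≤ 10, a ≤ 5, `z = 0`
and the TA / threshold / `S = (1−z)M` corners included): with the MIDS-FIRST split (`x_P`, then `x_K`, the rest to the giants) the hypotheses of
this theorem hold in EVERY instance in which `Q` is DEC, in every class `{m,M,G}×{m,M,G}` — so nothing is lost by this routing shape; and `Q`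
fails to be DEC in these classes only in class `mG` (`k₁+a` a mid `≤ t`, `k₂` a giant; 23 / 24 776), the genuine-mixture cell of the typer.
HONEST STATUS: `GatedSliceMixLaw'` (regime R), CW, `GateMove`, `GatedConvEmptyFree`, `SingleGateConvClosed`, `TreeDEC`, `FarTreeRow` OPEN;
RATE class log\* / honest sentence of `run/shared/lean/prim/quant/README.md` unchanged.

* `LawDec.mixLawQ_eq_atoms` — the five-atom form of `Q`.
* **`LawDec.mixLawQ_decAtT_of_routing`** — the routing theorem (DEC form).
* `LawDec.gatedSliceMixLaw'_of_routing` — the node's conclusion with `θ = 0` from a routing.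

[this work]; offers criterion: prim-quant-arm-1 g39; flow form: prim-quant-stmt g22–g26; node: prim-quant-stmt g29 (this lane).  Nothing
here is cited as a published result.  The gluing rows served [cite: KozmaNitzan2024, Conjecture 3 (p. 15)]; product measure
[cite: Grimmett1999, §1.3 p. 10].
-/

noncomputable section

namespace Summit.CriticalPhenomena.PercolationContinuityZ3.Theorems

namespace Quant

open Finset

/-- the two-point law `{lo, hi; g}` (as in `…QuantLawDEC`) -/
local notation3 "TP[" lo ", " hi ", " g ", " h "]" =>
  (g : ℝ) * (if (h : ℕ) = (hi : ℕ) then (1 : ℝ) else 0) + (1 - (g : ℝ)) * (if (h : ℕ) = (lo : ℕ) then (1 : ℝ) else 0)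

namespace LawDec

/-! ### The five-atom form of `Q` -/

/-- **`Q = z·δ₀ + A·δ_{k₁} + B·δ_{k₁+a} + C·δ_{k₂} + D·δ_{k₂+a}`** with `A = (1−z)(1−λ)(1−g)`, `B = (1−z)(1−λ)g`, `C = (1−z)λ(1−g)`,
`D = (1−z)λg`. [this work] -/
theorem mixLawQ_eq_atoms (z g lam : ℝ) (a k₁ k₂ : ℕ) (p : ℕ) :
    z * (if p = 0 then (1 : ℝ) else 0) + (1 - z) * slice (fun q => TP[k₁, k₂, lam, q]) a g p
      = z * (if p = 0 then (1 : ℝ) else 0) + (1 - z) * (1 - lam) * (1 - g) * (if p = k₁ then (1 : ℝ) else 0)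
        + (1 - z) * (1 - lam) * g * (if p = k₁ + a then (1 : ℝ) else 0)
        + (1 - z) * lam * (1 - g) * (if p = k₂ then (1 : ℝ) else 0)
        + (1 - z) * lam * g * (if p = k₂ + a then (1 : ℝ) else 0) := by
  rw [slice_TP]
  ring

/-- `Σ_{h < N} f h · [h = p]·c = f p · c` for `p < N`. -/
private theorem sum_mul_ite_eq (N p : ℕ) (f : ℕ → ℝ) (c : ℝ) (hp : p < N) :
    ∑ h ∈ Finset.range N, f h * (if h = p then c else 0) = f p * c := by
  rw [Finset.sum_eq_single p]
  · rw [if_pos rfl]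
  · intro h _ hne; rw [if_neg hne, mul_zero]
  · intro hn; exact absurd (Finset.mem_range.2 hp) hn

/-! ### The routing theorem -/

/-- **THE EXPLICIT ROUTING THEOREM FOR `Q` WITH THE SINGLE NONZERO LOW `k₁`.**  See the file header: `x_P + x_K + x_G = A` split the low `k₁`
over its compatible absorbers `P = k₁+a`, `K = k₂`, `G = k₂+a` within capacity, and the zero fits the priced leftovers
(`flowAtT_of_offers`). [this work] -/
theorem mixLawQ_decAtT_of_routing (y z g S lam : ℝ) (a j M k₁ k₂ : ℕ) (xP xK xG : ℝ)
    (hy0 : 0 < y) (hy1 : y < 1) (hz0 : 0 ≤ z) (hz1 : z < 1) (hg1 : g ≤ 1) (hyg : y ≤ (1 - z) * g) (ha : 1 ≤ a)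
    (hta : y * (M : ℝ) ≤ S) (hk : k₁ ≤ k₂) (hk₂M : k₂ ≤ M) (hlam0 : 0 ≤ lam) (hlam1 : lam ≤ 1)
    (hmean : (1 - z) * ((k₁ : ℝ) + ((k₂ : ℝ) - k₁) * lam) = S)
    -- regime: `k₁ ≥ 1` is a `t`-low, `k₁ + a` and `k₂` are not, `k₂ + a` is a giant
    (hk₁ : 1 ≤ k₁) (hk₁j : k₁ ≤ j) (hk₁low : 2 * (k₁ : ℝ) < S + (a : ℝ) * g * (1 - z))
    (hP : S + (a : ℝ) * g * (1 - z) ≤ 2 * ((k₁ + a : ℕ) : ℝ) ∨ j < k₁ + a)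
    (hK : S + (a : ℝ) * g * (1 - z) ≤ 2 * (k₂ : ℝ) ∨ j < k₂)
    (hG : j + 1 ≤ k₂ + a)
    -- the routing of the low `k₁`
    (hxP0 : 0 ≤ xP) (hxK0 : 0 ≤ xK) (hxG0 : 0 ≤ xG) (hsplit : xP + xK + xG = (1 - z) * (1 - lam) * (1 - g))
    (hPcomp : 0 < xP → (j + 1 ≤ k₁ + a ∨ S + (a : ℝ) * g * (1 - z) < (k₁ : ℝ) + ((k₁ + a : ℕ) : ℝ)))
    (hKcomp : 0 < xK → (j + 1 ≤ k₂ ∨ S + (a : ℝ) * g * (1 - z) < (k₁ : ℝ) + (k₂ : ℝ)))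
    (hcapP : usage y (S + (a : ℝ) * g * (1 - z)) j k₁ (k₁ + a) * xP ≤ (1 - z) * (1 - lam) * g)
    (hcapK : usage y (S + (a : ℝ) * g * (1 - z)) j k₁ k₂ * xK ≤ (1 - z) * lam * (1 - g))
    (hcapG : usage y (S + (a : ℝ) * g * (1 - z)) j k₁ (k₂ + a) * xG ≤ (1 - z) * lam * g)
    -- the zero fits the priced leftovers
    (hoffer : (S + (a : ℝ) * g * (1 - z)) * z ≤
        (if j + 1 ≤ k₁ + a then (S + (a : ℝ) * g * (1 - z)) * (1 - y) / y
          else if S + (a : ℝ) * g * (1 - z) < ((k₁ + a : ℕ) : ℝ) then ((k₁ + a : ℕ) : ℝ) - (S + (a : ℝ) * g * (1 - z)) else 0)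
          * ((1 - z) * (1 - lam) * g - usage y (S + (a : ℝ) * g * (1 - z)) j k₁ (k₁ + a) * xP)
        + (if j + 1 ≤ k₂ then (S + (a : ℝ) * g * (1 - z)) * (1 - y) / y
          else if S + (a : ℝ) * g * (1 - z) < (k₂ : ℝ) then (k₂ : ℝ) - (S + (a : ℝ) * g * (1 - z)) else 0)
          * ((1 - z) * lam * (1 - g) - usage y (S + (a : ℝ) * g * (1 - z)) j k₁ k₂ * xK)
        + (S + (a : ℝ) * g * (1 - z)) * (1 - y) / y
          * ((1 - z) * lam * g - usage y (S + (a : ℝ) * g * (1 - z)) j k₁ (k₂ + a) * xG)) :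
    DECAtT y (S + (a : ℝ) * g * (1 - z)) j (M + a)
      (fun p => z * (if p = 0 then (1 : ℝ) else 0) + (1 - z) * slice (fun q => TP[k₁, k₂, lam, q]) a g p) := by
  classical
  -- names
  set t : ℝ := S + (a : ℝ) * g * (1 - z) with ht
  set A : ℝ := (1 - z) * (1 - lam) * (1 - g) with hA
  set B : ℝ := (1 - z) * (1 - lam) * g with hB
  set C : ℝ := (1 - z) * lam * (1 - g) with hC
  set D : ℝ := (1 - z) * lam * g with hD
  have hg0 : 0 < g := by
    by_contra hc
    have : (1 - z) * g ≤ 0 := mul_nonpos_of_nonneg_of_nonpos (by linarith) (not_lt.1 hc)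
    linarith
  have h1z : 0 < 1 - z := by linarith
  have hA0 : 0 ≤ A := mul_nonneg (mul_nonneg h1z.le (by linarith)) (by linarith)
  have hB0 : 0 ≤ B := mul_nonneg (mul_nonneg h1z.le (by linarith)) hg0.le
  have hC0 : 0 ≤ C := mul_nonneg (mul_nonneg h1z.le hlam0) (by linarith)
  have hD0 : 0 ≤ D := mul_nonneg (mul_nonneg h1z.le hlam0) hg0.le
  have ha0 : (0 : ℝ) < a := by exact_mod_cast (Nat.lt_of_lt_of_le Nat.zero_lt_one ha)
  have hk₁r : (1 : ℝ) ≤ k₁ := by exact_mod_cast hk₁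
  have hkr : (k₁ : ℝ) ≤ k₂ := by exact_mod_cast hk
  have htpos : 0 < t := by
    have hd : 0 ≤ ((k₂ : ℝ) - k₁) * lam := mul_nonneg (by linarith) hlam0
    have hS' : (1 - z) * (k₁ : ℝ) ≤ S := by
      rw [← hmean]
      exact mul_le_mul_of_nonneg_left (by linarith) h1z.le
    have hpos : (0:ℝ) < (1 - z) * k₁ := mul_pos h1z (by linarith)
    have h2 : 0 ≤ (a : ℝ) * g * (1 - z) := mul_nonneg (mul_nonneg ha0.le hg0.le) h1z.le
    rw [ht]; linarith
  -- positions
  have hk₁k₂ : k₁ < k₂ := by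
    rcases Nat.eq_or_lt_of_le hk with heq | hlt
    · exfalso
      rcases hK with h2 | h2
      · rw [← heq] at h2; linarith
      · omega
    · exact hlt
  have hPne : k₁ + a ≠ k₁ := by omega
  have hKne : k₂ ≠ k₁ := by omega
  have hGne : k₂ + a ≠ k₁ := by omega
  have hGneP : k₂ + a ≠ k₁ + a := by omega
  have hGneK : k₂ + a ≠ k₂ := by omega
  have hPN : k₁ + a < M + a + 1 := by omega
  have hKN : k₂ < M + a + 1 := by omega
  have hGN : k₂ + a < M + a + 1 := by omega
  -- the five-atom form (an opaque name with an unfolding equation, to keep `if`s syntactic)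
  obtain ⟨Q, hQdef⟩ : ∃ Q : ℕ → ℝ, ∀ p, Q p = z * (if p = 0 then (1 : ℝ) else 0) + A * (if p = k₁ then (1 : ℝ) else 0)
      + B * (if p = k₁ + a then (1 : ℝ) else 0) + C * (if p = k₂ then (1 : ℝ) else 0)
      + D * (if p = k₂ + a then (1 : ℝ) else 0) := ⟨fun p => _, fun p => rfl⟩
  have hQp : ∀ p, z * (if p = 0 then (1 : ℝ) else 0) + (1 - z) * slice (fun q => TP[k₁, k₂, lam, q]) a g p = Q p := by
    intro p
    rw [hQdef, mixLawQ_eq_atoms]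
  obtain ⟨q0', qM', q1', -⟩ := gateCell_laws z g lam a M k₁ k₂ hz0 hz1.le hg0.le hg1 hlam0 hlam1 (hk.trans hk₂M) hk₂M
  have q0 : ∀ h, 0 ≤ Q h := fun h => by rw [← hQp h]; exact q0' h
  have qM : ∀ h, M + a < h → Q h = 0 := fun h hh => by rw [← hQp h]; exact qM' h hh
  have q1 : ∑ h ∈ Finset.range (M + a + 1), Q h = 1 := by
    rw [← q1']; exact Finset.sum_congr rfl fun h _ => (hQp h).symm
  -- values of `Q`
  have hQ0 : Q 0 = z := by
    rw [hQdef, if_pos rfl, if_neg (by omega : (0:ℕ) ≠ k₁), if_neg (by omega : (0:ℕ) ≠ k₁ + a),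
      if_neg (by omega : (0:ℕ) ≠ k₂), if_neg (by omega : (0:ℕ) ≠ k₂ + a)]; ring
  have hQk₁ : Q k₁ = A := by
    rw [hQdef, if_neg (by omega : k₁ ≠ 0), if_pos rfl, if_neg (Ne.symm hPne), if_neg (Ne.symm hKne), if_neg (Ne.symm hGne)]; ring
  have hQP : Q (k₁ + a) = B + (if k₁ + a = k₂ then C else 0) := by
    rw [hQdef, if_neg (by omega : k₁ + a ≠ 0), if_neg hPne, if_pos rfl, if_neg (Ne.symm hGneP)]
    by_cases hc : k₁ + a = k₂
    · rw [if_pos hc, if_pos hc]; ring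
    · rw [if_neg hc, if_neg hc]; ring
  have hQK : Q k₂ = C + (if k₁ + a = k₂ then B else 0) := by
    rw [hQdef, if_neg (by omega : k₂ ≠ 0), if_neg hKne, if_pos rfl, if_neg (Ne.symm hGneK)]
    by_cases hc : k₁ + a = k₂
    · rw [if_pos hc.symm, if_pos hc]; ring
    · rw [if_neg (fun h' => hc h'.symm), if_neg hc]; ring
  have hQG : Q (k₂ + a) = D := by
    rw [hQdef, if_neg (by omega : k₂ + a ≠ 0), if_neg hGne, if_neg hGneP, if_neg hGneK, if_pos rfl]; ring
  have hQoff : ∀ p, p ≠ 0 → p ≠ k₁ → p ≠ k₁ + a → p ≠ k₂ → p ≠ k₂ + a → Q p = 0 := by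
    intro p h0 h1 h2 h3 h4
    rw [hQdef, if_neg h0, if_neg h1, if_neg h2, if_neg h3, if_neg h4]; ring
  refine decAtT_congr (fun p => (hQp p).symm) ?_
  refine decAtT_of_flowAtT y t j (M + a) Q hy0 hy1 qM q1 ?_
  -- the routing of the low `k₁` (opaque name)
  obtain ⟨φ, hφdef⟩ : ∃ φ : ℕ → ℕ → ℝ, ∀ l h, φ l h = if l = k₁ then
      ((if h = k₁ + a then xP else 0) + (if h = k₂ then xK else 0) + (if h = k₂ + a then xG else 0)) else 0 :=
    ⟨fun l h => _, fun l h => rfl⟩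
  have hφk₁ : ∀ h, φ k₁ h = (if h = k₁ + a then xP else 0) + (if h = k₂ then xK else 0) + (if h = k₂ + a then xG else 0) := by
    intro h; rw [hφdef, if_pos rfl]
  have hφne : ∀ l h, l ≠ k₁ → φ l h = 0 := by
    intro l h hl; rw [hφdef, if_neg hl]
  have hφP : φ k₁ (k₁ + a) = xP + (if k₁ + a = k₂ then xK else 0) := by
    rw [hφk₁, if_pos rfl, if_neg (Ne.symm hGneP)]; ring
  have hφK : φ k₁ k₂ = xK + (if k₁ + a = k₂ then xP else 0) := by
    rw [hφk₁, if_pos rfl, if_neg (Ne.symm hGneK)]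
    by_cases hc : k₁ + a = k₂
    · rw [if_pos hc.symm, if_pos hc]; ring
    · rw [if_neg (fun h' => hc h'.symm), if_neg hc]; ring
  have hφG : φ k₁ (k₂ + a) = xG := by
    rw [hφk₁, if_neg hGneP, if_neg hGneK, if_pos rfl]; ring
  have hφoff : ∀ h, h ≠ k₁ + a → h ≠ k₂ → h ≠ k₂ + a → φ k₁ h = 0 := by
    intro h h1 h2 h3; rw [hφk₁, if_neg h1, if_neg h2, if_neg h3]; ring
  have hφ0 : ∀ l h, 0 ≤ φ l h := by
    intro l h
    by_cases hl : l = k₁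
    · rw [hl, hφk₁]
      refine add_nonneg (add_nonneg ?_ ?_) ?_ <;> split_ifs <;> first | exact le_rfl | assumption
    · rw [hφne l h hl]
  -- top-affordability of the mids above `t`
  have htaM : ∀ h : ℕ, h ≤ j → h ≤ M + a → t < (h : ℝ) → y * (h : ℝ) ≤ t := by
    intro h _ hhM _
    have hh : (h : ℝ) ≤ (M : ℝ) + a := by exact_mod_cast hhM
    have h1 : y * (h : ℝ) ≤ y * (M : ℝ) + y * a := by
      calc y * (h : ℝ) ≤ y * ((M : ℝ) + a) := mul_le_mul_of_nonneg_left hh hy0.le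
        _ = y * (M : ℝ) + y * a := by ring
    have h3 : y * (a : ℝ) ≤ (a : ℝ) * g * (1 - z) := by
      calc y * (a : ℝ) ≤ (1 - z) * g * (a : ℝ) := mul_le_mul_of_nonneg_right hyg (Nat.cast_nonneg a)
        _ = (a : ℝ) * g * (1 - z) := by ring
    rw [ht]; linarith
  -- column loads: only the row `k₁` is charged
  have hload : ∀ h, ∑ l ∈ Finset.range (j + 1), usage y t j l h * φ l h = usage y t j k₁ h * φ k₁ h := by
    intro h
    rw [Finset.sum_eq_single k₁]
    · intro l _ hl; rw [hφne l h hl, mul_zero]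
    · intro hn; exact absurd (Finset.mem_range.2 (Nat.lt_succ_of_le hk₁j)) hn
  -- when the twin and the top coincide, their usage rates coincide
  have husePK : k₁ + a = k₂ → usage y t j k₁ (k₁ + a) = usage y t j k₁ k₂ := by
    intro hc; rw [hc]
  refine flowAtT_of_offers y t j (M + a) Q φ hy0 hy1 htpos q0 htaM hφ0 ?_ ?_ ?_ ?_
  · -- support of the routing
    intro l h hp
    have hl : l = k₁ := by
      by_contra hne; rw [hφne l h hne] at hp; exact lt_irrefl _ hp
    subst hl
    refine ⟨⟨hk₁, hk₁j, hk₁low⟩, ?_⟩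
    by_cases h1 : h = l + a
    · subst h1
      rw [hφP] at hp
      refine ⟨by omega, ?_⟩
      by_cases hc : l + a = k₂
      · rw [if_pos hc] at hp
        rcases (hxP0).eq_or_lt with hP0 | hPpos
        · have hKpos : 0 < xK := by rw [← hP0] at hp; linarith
          rcases hKcomp hKpos with h2 | h2
          · exact Or.inl (hc ▸ h2)
          · right; rw [hc]; exact h2
        · exact hPcomp hPpos
      · rw [if_neg hc] at hp
        exact hPcomp (by linarith)
    · by_cases h2 : h = k₂
      · subst h2
        have hc : ¬ (l + a = h) := fun h' => h1 h'.symm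
        rw [hφK, if_neg hc] at hp
        exact ⟨by omega, hKcomp (by linarith)⟩
      · by_cases h3 : h = k₂ + a
        · subst h3
          exact ⟨by omega, Or.inl hG⟩
        · rw [hφoff h h1 h2 h3] at hp
          exact absurd hp (lt_irrefl _)
  · -- rows: the low `k₁` is shipped exactly, no other nonzero low is charged
    intro l hl1 hlj hlow
    by_cases hl : l = k₁
    · subst hl
      rw [Finset.sum_congr rfl (fun h _ => hφk₁ h), Finset.sum_add_distrib, Finset.sum_add_distrib,
        Finset.sum_ite_eq' (Finset.range (M + a + 1)) (l + a), Finset.sum_ite_eq' (Finset.range (M + a + 1)) k₂,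
        Finset.sum_ite_eq' (Finset.range (M + a + 1)) (k₂ + a),
        if_pos (Finset.mem_range.2 hPN), if_pos (Finset.mem_range.2 hKN), if_pos (Finset.mem_range.2 hGN), hQk₁, hsplit]
    · rw [Finset.sum_eq_zero (fun h _ => hφne l h hl)]
      have hlP : l ≠ k₁ + a := by
        rintro rfl
        rcases hP with h2 | h2
        · linarith
        · omega
      have hlK : l ≠ k₂ := by
        rintro rfl
        rcases hK with h2 | h2
        · linarith
        · omega
      rw [hQoff l (by omega) hl hlP hlK (by omega)]
  · -- columns: capacities
    intro h hhM habs
    rw [hload h]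
    by_cases h1 : h = k₁ + a
    · subst h1
      rw [hφP, hQP]
      by_cases hc : k₁ + a = k₂
      · rw [if_pos hc, if_pos hc, mul_add, husePK hc]
        have := hcapP; rw [husePK hc] at this
        linarith [hcapK]
      · rw [if_neg hc, if_neg hc, add_zero, add_zero]; exact hcapP
    · by_cases h2 : h = k₂
      · subst h2
        have hc : ¬ (k₁ + a = h) := fun h' => h1 h'.symm
        rw [hφK, hQK, if_neg hc, if_neg hc, add_zero, add_zero]
        exact hcapK
      · by_cases h3 : h = k₂ + a
        · subst h3
          rw [hφG, hQG]; exact hcapG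
        · rw [hφoff h h1 h2 h3, mul_zero]
          exact q0 h
  · -- the zero's offer inequality
    rw [hQ0]
    have e : ∀ h ∈ Finset.range (M + a + 1),
        (if j + 1 ≤ h then t * (1 - y) / y else if t < (h : ℝ) then (h : ℝ) - t else 0)
          * (Q h - ∑ l ∈ Finset.range (j + 1), usage y t j l h * φ l h)
        = (if h = k₁ + a then
            (if j + 1 ≤ k₁ + a then t * (1 - y) / y else if t < ((k₁ + a : ℕ) : ℝ) then ((k₁ + a : ℕ) : ℝ) - t else 0)
              * (B - usage y t j k₁ (k₁ + a) * xP) else 0)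
          + (if h = k₂ then
            (if j + 1 ≤ k₂ then t * (1 - y) / y else if t < (k₂ : ℝ) then (k₂ : ℝ) - t else 0)
              * (C - usage y t j k₁ k₂ * xK) else 0)
          + (if h = k₂ + a then t * (1 - y) / y * (D - usage y t j k₁ (k₂ + a) * xG) else 0) := by
      intro h _
      rw [hload h]
      by_cases h1 : h = k₁ + a
      · subst h1
        rw [hQP, hφP, if_pos rfl, if_neg (Ne.symm hGneP)]
        by_cases hc : k₁ + a = k₂
        · rw [if_pos hc, if_pos hc, if_pos hc, ← husePK hc, ← hc]; ring
        · rw [if_neg hc, if_neg hc, if_neg hc]; ring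
      · rw [if_neg h1]
        by_cases h2 : h = k₂
        · subst h2
          have hc : ¬ (k₁ + a = h) := fun h' => h1 h'.symm
          rw [hQK, hφK, if_neg hc, if_neg hc, if_pos rfl, if_neg (Ne.symm hGneK)]
          ring
        · rw [if_neg h2]
          by_cases h3 : h = k₂ + a
          · subst h3
            rw [hQG, hφG, if_pos rfl, if_pos hG]; ring
          · rw [if_neg h3, hφoff h h1 h2 h3, mul_zero, sub_zero]
            by_cases h0 : h = 0
            · subst h0; rw [hQ0, if_neg (by omega)]; push_cast; rw [if_neg (not_lt.2 htpos.le)]; ring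
            · by_cases h4 : h = k₁
              · subst h4; rw [hQk₁, if_neg (by omega), if_neg (by linarith)]; ring
              · rw [hQoff h h0 h4 h1 h2 h3]; ring
    rw [Finset.sum_congr rfl e, Finset.sum_add_distrib, Finset.sum_add_distrib,
      Finset.sum_ite_eq' (Finset.range (M + a + 1)) (k₁ + a), Finset.sum_ite_eq' (Finset.range (M + a + 1)) k₂,
      Finset.sum_ite_eq' (Finset.range (M + a + 1)) (k₂ + a),
      if_pos (Finset.mem_range.2 hPN), if_pos (Finset.mem_range.2 hKN), if_pos (Finset.mem_range.2 hGN)]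
    exact hoffer

/-- **`GatedSliceMixLaw'` in regime R from a routing (θ = 0).**  The node's conclusion for `μ₂ = {k₁, k₂; λ}` with `k₁ ≥ 1` the only nonzero
`t`-low of `Q`, from the data of `mixLawQ_decAtT_of_routing`; the weak-mid law and its non-DEC hypothesis are not used. [this work] -/
theorem gatedSliceMixLaw'_of_routing (y z g S lam : ℝ) (a j M h k₁ k₂ : ℕ) (xP xK xG : ℝ)
    (hy0 : 0 < y) (hy1 : y < 1) (hz0 : 0 ≤ z) (hz1 : z < 1) (hg1 : g ≤ 1) (hyg : y ≤ (1 - z) * g) (ha : 1 ≤ a)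
    (hta : y * (M : ℝ) ≤ S) (hk : k₁ ≤ k₂) (hk₂M : k₂ ≤ M) (hlam0 : 0 ≤ lam) (hlam1 : lam ≤ 1)
    (hmean : (1 - z) * ((k₁ : ℝ) + ((k₂ : ℝ) - k₁) * lam) = S)
    (hk₁ : 1 ≤ k₁) (hk₁j : k₁ ≤ j) (hk₁low : 2 * (k₁ : ℝ) < S + (a : ℝ) * g * (1 - z))
    (hP : S + (a : ℝ) * g * (1 - z) ≤ 2 * ((k₁ + a : ℕ) : ℝ) ∨ j < k₁ + a)
    (hK : S + (a : ℝ) * g * (1 - z) ≤ 2 * (k₂ : ℝ) ∨ j < k₂)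
    (hG : j + 1 ≤ k₂ + a)
    (hxP0 : 0 ≤ xP) (hxK0 : 0 ≤ xK) (hxG0 : 0 ≤ xG) (hsplit : xP + xK + xG = (1 - z) * (1 - lam) * (1 - g))
    (hPcomp : 0 < xP → (j + 1 ≤ k₁ + a ∨ S + (a : ℝ) * g * (1 - z) < (k₁ : ℝ) + ((k₁ + a : ℕ) : ℝ)))
    (hKcomp : 0 < xK → (j + 1 ≤ k₂ ∨ S + (a : ℝ) * g * (1 - z) < (k₁ : ℝ) + (k₂ : ℝ)))
    (hcapP : usage y (S + (a : ℝ) * g * (1 - z)) j k₁ (k₁ + a) * xP ≤ (1 - z) * (1 - lam) * g)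
    (hcapK : usage y (S + (a : ℝ) * g * (1 - z)) j k₁ k₂ * xK ≤ (1 - z) * lam * (1 - g))
    (hcapG : usage y (S + (a : ℝ) * g * (1 - z)) j k₁ (k₂ + a) * xG ≤ (1 - z) * lam * g)
    (hoffer : (S + (a : ℝ) * g * (1 - z)) * z ≤
        (if j + 1 ≤ k₁ + a then (S + (a : ℝ) * g * (1 - z)) * (1 - y) / y
          else if S + (a : ℝ) * g * (1 - z) < ((k₁ + a : ℕ) : ℝ) then ((k₁ + a : ℕ) : ℝ) - (S + (a : ℝ) * g * (1 - z)) else 0)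
          * ((1 - z) * (1 - lam) * g - usage y (S + (a : ℝ) * g * (1 - z)) j k₁ (k₁ + a) * xP)
        + (if j + 1 ≤ k₂ then (S + (a : ℝ) * g * (1 - z)) * (1 - y) / y
          else if S + (a : ℝ) * g * (1 - z) < (k₂ : ℝ) then (k₂ : ℝ) - (S + (a : ℝ) * g * (1 - z)) else 0)
          * ((1 - z) * lam * (1 - g) - usage y (S + (a : ℝ) * g * (1 - z)) j k₁ k₂ * xK)
        + (S + (a : ℝ) * g * (1 - z)) * (1 - y) / y
          * ((1 - z) * lam * g - usage y (S + (a : ℝ) * g * (1 - z)) j k₁ (k₂ + a) * xG)) :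
    ∃ θ : ℝ, 0 ≤ θ ∧ θ < 1 ∧
      DECAtT y (S + (a : ℝ) * g * (1 - z)) j (M + a)
        (fun p => θ * weakMidLaw S g h a p
          + (1 - θ) * (z * (if p = 0 then (1 : ℝ) else 0) + (1 - z) * slice (fun q => TP[k₁, k₂, lam, q]) a g p)) := by
  refine ⟨0, le_rfl, zero_lt_one, ?_⟩
  refine decAtT_congr (fun p => ?_)
    (mixLawQ_decAtT_of_routing y z g S lam a j M k₁ k₂ xP xK xG hy0 hy1 hz0 hz1 hg1 hyg ha hta hk hk₂M hlam0 hlam1 hmean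
      hk₁ hk₁j hk₁low hP hK hG hxP0 hxK0 hxG0 hsplit hPcomp hKcomp hcapP hcapK hcapG hoffer)
  ring

end LawDec

end Quant

end Summit.CriticalPhenomena.PercolationContinuityZ3.Theorems
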